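import Summits.CriticalPhenomena.PercolationContinuityZ3.Theses.PercBurnResprinkle
import Literature.Probability.Percolation.PercolationProofs

/-!
# Route `PercBurnResprinkle`, item `Assembly` (stmt-CriticalPhenomena-7207)

`Assembly` says `VacantReignition → JumpFireBreak → PercolationContinuityZ3` (`θ_{ℤ³}(p_c) = 0`).

Proof (pure monotonicity of the standard coupling, no measurability used): suppose `θ(p_c) ≠ 0`;
`θ` is a probability, so `θ(p_c) > 0`. `JumpFireBreak` then yields `ε > 0` such that the set `N` of
label pairs `π = (U, U′)` for which SOME vertex has an infinite cluster in the vacant fresh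
configuration (environment level `p_c`, field level `p_c + ε`) is `labelMeasure ⊗ labelMeasure`-null.
`VacantReignition` at this `ε` yields `p > p_c` such that the set `S` of label pairs for which the
ORIGIN has an infinite cluster in the vacant fresh configuration (environment level `p`, field level
`p_c + ε`) has positive (real) measure. Pointwise, `configOfLabels p_c U ⊆ configOfLabels p U`
(`configOfLabels_mono`), so every level-`p_c` cluster is contained in the corresponding level-`p`
cluster (`openCluster_mono`), so the burnt set grows with the environment level and the vacant fresh
configuration at level `p` is contained in the one at level `p_c`; hence its clusters are smaller and
`S ⊆ N` (witness `x = 0`). Then `μ S = 0` by `measure_mono_null`, contradicting `0 < μ.real S`.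
-/

namespace Summit.CriticalPhenomena.PercolationContinuityZ3.Theorems

open MeasureTheory Literature.Probability.Percolation Literature.Probability.LatticeModels

/-- **Item `stmt-CriticalPhenomena-7207` (`PercBurnResprinkle.Assembly`), proved.**
`VacantReignition → JumpFireBreak → PercolationContinuityZ3`: if `θ(p_c) > 0`, the fire-break's null
event (some vertex percolates in the vacant fresh configuration at environment level `p_c`, field
level `p_c + ε`) contains the re-ignition event (the origin percolates at environment level `p > p_c`,
same field level), because raising the environment level enlarges the burnt set
(`configOfLabels_mono`, `openCluster_mono`) and so shrinks the vacant fresh configuration; a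
positive-measure set inside a null set is absurd. Hence `θ(p_c) = 0`. [folklore] -/
theorem assembly_proof :
    Summit.CriticalPhenomena.PercolationContinuityZ3.Theses.PercBurnResprinkle.Assembly := by
  unfold Summit.CriticalPhenomena.PercolationContinuityZ3.Theses.PercBurnResprinkle.Assembly
    Summit.CriticalPhenomena.PercolationContinuityZ3.Theses.PercBurnResprinkle.VacantReignition
    Summit.CriticalPhenomena.PercolationContinuityZ3.Theses.PercBurnResprinkle.JumpFireBreak
  intro hVR hJFB
  -- `PercolationContinuityZ3` is `θ (zdGraph 3) 0 (p_c) = 0`; argue by contradiction.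
  show theta (zdGraph 3) (0 : Fin 3 → ℤ) (criticalProbI 3) = 0
  by_contra hne
  have h0 : 0 ≤ theta (zdGraph 3) (0 : Fin 3 → ℤ) (criticalProbI 3) := by
    unfold theta
    exact measureReal_nonneg
  have hpos : 0 < theta (zdGraph 3) (0 : Fin 3 → ℤ) (criticalProbI 3) :=
    lt_of_le_of_ne h0 (fun h => hne h.symm)
  -- the fire-break: a null event at environment level `p_c`
  obtain ⟨ε, hε, hnull⟩ := hJFB hpos
  -- re-ignition at this `ε`: a positive-measure event at some environment level `p > p_c`
  obtain ⟨p, hp, hS⟩ := hVR ε hε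
  -- notation
  set G := zdGraph 3 with hG
  set pc := criticalProb (zdGraph 3) (0 : Fin 3 → ℤ) with hpc
  -- the positive-measure event is contained in the null event (witness `x = 0`)
  have hsub :
      {π : (Sym2 (Fin 3 → ℤ) → ℝ) × (Sym2 (Fin 3 → ℤ) → ℝ) |
          (openCluster {e | e ∈ configOfLabels (pc + ε) π.2 G ∧
              ∀ y ∈ e, ¬ (openCluster (configOfLabels p π.1 G) y).Infinite} (0 : Fin 3 → ℤ)).Infinite}
        ⊆ {π : (Sym2 (Fin 3 → ℤ) → ℝ) × (Sym2 (Fin 3 → ℤ) → ℝ) |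
          ∃ x : Fin 3 → ℤ, (openCluster {e | e ∈ configOfLabels (pc + ε) π.2 G ∧
              ∀ y ∈ e, ¬ (openCluster (configOfLabels pc π.1 G) y).Infinite} x).Infinite} := by
    intro π hπ
    refine ⟨0, Set.Infinite.mono (openCluster_mono ?_ 0) hπ⟩
    -- the vacant fresh configuration shrinks as the environment level rises from `p_c` to `p`
    rintro e ⟨he, hvac⟩
    refine ⟨he, fun y hy hinf => hvac y hy ?_⟩
    exact hinf.mono (openCluster_mono (configOfLabels_mono π.1 G hp.le) y)
  have hzero := measure_mono_null hsub hnull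
  have hreal : ((labelMeasure (Fin 3 → ℤ)).prod (labelMeasure (Fin 3 → ℤ))).real
      {π : (Sym2 (Fin 3 → ℤ) → ℝ) × (Sym2 (Fin 3 → ℤ) → ℝ) |
          (openCluster {e | e ∈ configOfLabels (pc + ε) π.2 G ∧
              ∀ y ∈ e, ¬ (openCluster (configOfLabels p π.1 G) y).Infinite} (0 : Fin 3 → ℤ)).Infinite}
        = 0 := by
    simp only [Measure.real, hzero, ENNReal.toReal_zero]
  exact absurd hreal hS.ne'

end Summit.CriticalPhenomena.PercolationContinuityZ3.Theorems
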